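import Mathlib
import Literature.RingTheory.Valuation.ValuationSubringHenselian
import HarnessLib

/-!
# Lifting idempotents along `A → A ⧸ 𝔪A` when every element of `A` satisfies a SPLIT monic relation over the local base `R`
# (Hensel-free case of [StacksProject 04GG]; covers finite algebras over the valuation ring of an algebraically closed field)

Let `(R, 𝔪)` be a local ring and `A` a commutative `R`-algebra.  Suppose `a ∈ A` is killed by a monic polynomial over `R` that
SPLITS INTO LINEAR FACTORS OVER `R`: `∏_{λ ∈ s} (a - λ) = 0` for a finite multiset `s ⊆ R`.  If the image of `a` in `A ⧸ I` is
idempotent, for an ideal `I ⊇ 𝔪A`, then `a` lifts: there is a genuine idempotent `e ∈ A` with `e ≡ a (mod I)`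
(`exists_isIdempotentElem_mk_eq_of_aeval_prod_X_sub_C_eq_zero`).  Proof: split `s` into the roots `λ ≡ 1 (mod 𝔪)` and the rest,
`p = g·h`; the factors are coprime in `R[X]` (`(X − μ) − (X − λ) = λ − μ` is a unit of the LOCAL ring `R` when `λ̄ = 1 ≠ μ̄`), so
`u g + v h = 1`; then `e := (v h)(a)` is idempotent because `(vh)(vh − 1) = −uv·gh` and `(gh)(a) = 0`, and `e ≡ a` because a polynomial
`r` takes the value `r(0)(1 − ā) + r(1) ā` at an idempotent `ā`, with `(vh)(1) ≡ 1` and `h(0)(1 − ā) ≡ 0 (mod I)`.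

When moreover `I ⊆ Jac(A)` (e.g. `I = 𝔪A` for `A` integral over `R`, `map_maximalIdeal_le_jacobson_bot`), complete orthogonal families of
idempotents lift (`exists_completeOrthogonalIdempotents_lift`): lifted idempotents of orthogonal classes are orthogonal and sum to `1`
automatically, since an idempotent in the Jacobson radical is `0`.

THE CASE THAT MATTERS for the cell (`hodgecm-mathlib`, FLOOR-0 P5a, D9op road 2′, (S-γ) row γ1 of the MOD-PLAN bridge «scheme-level special-fibre
decomposition ⇒ pointwise multiset letter»): `R = V` a valuation subring of an ALGEBRAICALLY CLOSED field `Ω` (e.g. `𝒪_{\bar K_v}`) and `A`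
integral over `V` (e.g. module-finite): every `a ∈ A` has a monic relation, which splits over `Ω`, and its roots lie in `V` (★
`ValuationSubring.mem_of_isRoot_map_of_monic`) — so the split hypothesis holds (`exists_aeval_prod_X_sub_C_eq_zero_of_valuationSubring`) and
every complete orthogonal family of idempotents of `A ⧸ 𝔪_V A` lifts to `A`
(`ValuationSubring.exists_completeOrthogonalIdempotents_lift`); with Mathlib's `CompleteOrthogonalIdempotents.bijective_pi` this is the
product decomposition `A ≅ ∏ A ⧸ (1 − eᵢ)` of a finite `V`-algebra into the blocks of its special fibre — WITHOUT Hensel's lemma.  The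
general henselian statement [StacksProject 04GG (1)⇒(5)] is NOT proved here.

Mathlib-only apart from the one ★ input; THEOREMS ONLY (no definition, no instance, no named fact, no `sorry`).

## References
* [StacksProject] The Stacks Project, Tag 04GG (10.153.3: henselian local rings, (5) «finite algebras are products of local rings»),
  Tag 09XI (15.11.6: henselian pairs ⇔ idempotents lift for integral algebras), Tag 00IC (normal domains: roots of monic polynomials),
  Tag 00J9 (idempotents and the Jacobson radical).
* [Matsumura1987] H. Matsumura, *Commutative Ring Theory*, Thm. 8.15 (decomposition along idempotents of the special fibre), Thm. 9.3
  (integral extensions: maximal ideals contract to maximal ideals).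
-/

set_option autoImplicit false

namespace Literature.RingTheory.Idempotents

open Polynomial IsLocalRing

/-! ### §1 Polynomials at an idempotent; coprime linear factors -/

section Elementary

variable {R A : Type*} [CommRing R] [CommRing A] [Algebra R A]

/-- **A polynomial at an idempotent**: `r(ē) = r(0)·(1 − ē) + r(1)·ē` (since `ēⁿ = ē` for `n ≥ 1`). [folklore] -/
private theorem aeval_eq_of_isIdempotentElem {e : A} (he : IsIdempotentElem e) (r : R[X]) :
    aeval e r = algebraMap R A (r.eval 0) * (1 - e) + algebraMap R A (r.eval 1) * e := by
  induction r using Polynomial.induction_on' with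
  | add p q hp hq =>
    rw [map_add, hp, hq, eval_add, eval_add, map_add, map_add]
    ring
  | monomial n c =>
    rw [aeval_monomial, eval_monomial, eval_monomial, one_pow, mul_one]
    rcases n with _ | m
    · rw [pow_zero, pow_zero, mul_one]
      ring
    · rw [he.pow_succ_eq m, zero_pow (Nat.succ_ne_zero m), mul_zero, map_zero, zero_mul, zero_add]

/-- `X − λ` and `X − μ` are coprime in `R[X]` when `λ − μ` is a unit: `c·(X − μ) − c·(X − λ) = c(λ − μ) = 1`. [folklore] -/
private theorem isCoprime_X_sub_C_of_isUnit_sub {a b : R} (h : IsUnit (a - b)) : IsCoprime (X - C a) (X - C b) := by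
  obtain ⟨c, hc⟩ := h.exists_left_inv
  refine ⟨-C c, C c, ?_⟩
  calc -C c * (X - C a) + C c * (X - C b) = C (c * (a - b)) := by
        rw [map_mul, map_sub]
        ring
    _ = 1 := by rw [hc, map_one]

/-- A product of linear factors each coprime to `q` is coprime to `q`. [folklore] -/
private theorem isCoprime_prod_X_sub_C_left (s : Multiset R) (q : R[X]) (h : ∀ a ∈ s, IsCoprime (X - C a) q) :
    IsCoprime (s.map fun a => X - C a).prod q := by
  induction s using Multiset.induction_on with
  | empty => rw [Multiset.map_zero, Multiset.prod_zero]; exact isCoprime_one_left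
  | cons a s ih =>
    rw [Multiset.map_cons, Multiset.prod_cons]
    exact IsCoprime.mul_left (h a (Multiset.mem_cons_self a s)) (ih fun a' ha' => h a' (Multiset.mem_cons_of_mem ha'))

/-- Products of pairwise coprime linear factors are coprime (multiset form). [folklore] -/
private theorem isCoprime_prod_X_sub_C (s t : Multiset R) (h : ∀ a ∈ s, ∀ b ∈ t, IsUnit (a - b)) :
    IsCoprime (s.map fun a => X - C a).prod (t.map fun b => X - C b).prod :=
  isCoprime_prod_X_sub_C_left s _ fun a ha =>
    (isCoprime_prod_X_sub_C_left t _ fun b hb => (isCoprime_X_sub_C_of_isUnit_sub (h a ha b hb)).symm).symm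

/-- `eval x` of a product of linear factors. [folklore] -/
private theorem eval_prod_X_sub_C (s : Multiset R) (x : R) : ((s.map fun a => X - C a).prod).eval x = (s.map fun a => x - a).prod := by
  rw [eval_multiset_prod, Multiset.map_map]
  refine congrArg Multiset.prod (Multiset.map_congr rfl fun a _ => ?_)
  simp only [Function.comp_apply, eval_sub, eval_X, eval_C]

/-- An idempotent in the Jacobson radical is zero (`1 − e` is a unit and `(1 − e)e = 0`). [cite: StacksProject, Tag 00J9] -/
theorem eq_zero_of_isIdempotentElem_of_mem_jacobson_bot {e : A} (he : IsIdempotentElem e) (h : e ∈ Ideal.jacobson (⊥ : Ideal A)) :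
    e = 0 := by
  have hu : IsUnit (e * (-1) + 1) := Ideal.mem_jacobson_bot.1 h (-1)
  have h1 : (e * (-1) + 1) * e = 0 := by
    have := he.eq
    linear_combination (-1 : A) * this
  exact (hu.mul_right_eq_zero).1 h1

end Elementary

/-! ### §2 Lifting one idempotent under a split relation -/

section Lift

variable {R A : Type*} [CommRing R] [IsLocalRing R] [CommRing A] [Algebra R A]

/-- In a local ring, if `λ ≡ 1 (mod 𝔪)` and `μ ≢ 1 (mod 𝔪)` then `λ − μ` is a unit. [folklore] -/
private theorem isUnit_sub_of_sub_one_mem_of_sub_one_not_mem {a b : R} (ha : a - 1 ∈ maximalIdeal R) (hb : b - 1 ∉ maximalIdeal R) :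
    IsUnit (a - b) := by
  by_contra hab
  apply hb
  have hab' : a - b ∈ maximalIdeal R := (mem_maximalIdeal _).2 (mem_nonunits_iff.2 hab)
  have : b - 1 = (a - 1) - (a - b) := by ring
  rw [this]
  exact Ideal.sub_mem _ ha hab'

/-- `λ ≡ 1 (mod 𝔪)` forces `λ` to be a unit. [folklore] -/
private theorem isUnit_of_sub_one_mem {a : R} (ha : a - 1 ∈ maximalIdeal R) : IsUnit a := by
  rcases isUnit_or_isUnit_one_sub_self a with h | h
  · exact h
  · exfalso
    have h' : (1 - a) ∈ maximalIdeal R := by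
      have : 1 - a = -(a - 1) := by ring
      rw [this]; exact (Ideal.neg_mem_iff _).2 ha
    exact (mem_maximalIdeal _).1 h' h

/-- `μ ≢ 1 (mod 𝔪)` forces `1 − μ` to be a unit. [folklore] -/
private theorem isUnit_one_sub_of_sub_one_not_mem {b : R} (hb : b - 1 ∉ maximalIdeal R) : IsUnit (1 - b) := by
  by_contra h
  apply hb
  have h' : 1 - b ∈ maximalIdeal R := (mem_maximalIdeal _).2 (mem_nonunits_iff.2 h)
  have : b - 1 = -(1 - b) := by ring
  rw [this]; exact (Ideal.neg_mem_iff _).2 h'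

/-- **Lifting an idempotent under a split monic relation** (Hensel-free special case of [StacksProject 04GG (5)]; [Matsumura1987] Ex. 8.3):
`R` local, `I ⊇ 𝔪A` an ideal of the commutative `R`-algebra `A`, `a ∈ A` with `∏_{λ ∈ s} (a − λ) = 0` for a finite multiset `s ⊆ R` and
`ā := a mod I` idempotent.  Then some idempotent `e ∈ A` has `e ≡ a (mod I)`. [cite: StacksProject, Tag 04GG] [cite: Matsumura1987, Thm. 8.15] -/
theorem exists_isIdempotentElem_mk_eq_of_aeval_prod_X_sub_C_eq_zero (I : Ideal A)
    (hI : (maximalIdeal R).map (algebraMap R A) ≤ I) (a : A) (ha : IsIdempotentElem (Ideal.Quotient.mk I a))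
    (s : Multiset R) (hs : aeval a (s.map fun x => X - C x).prod = 0) :
    ∃ e : A, IsIdempotentElem e ∧ Ideal.Quotient.mk I e = Ideal.Quotient.mk I a := by
  classical
  -- notation: the quotient as an `R`-algebra, `ā`, and the evaluation rule at `ā`
  set π : A →ₐ[R] A ⧸ I := Ideal.Quotient.mkₐ R I
  have hπa : ∀ x, π x = Ideal.Quotient.mk I x := fun x => rfl
  set ab := Ideal.Quotient.mk I a with hab
  have halg : ∀ r : R, r ∈ maximalIdeal R → algebraMap R (A ⧸ I) r = 0 := fun r hr => by
    rw [IsScalarTower.algebraMap_apply R A (A ⧸ I), Ideal.Quotient.algebraMap_eq, Ideal.Quotient.eq_zero_iff_mem]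
    exact hI (Ideal.mem_map_of_mem _ hr)
  have heval : ∀ r : R[X], Ideal.Quotient.mk I (aeval a r) =
      algebraMap R (A ⧸ I) (r.eval 0) * (1 - ab) + algebraMap R (A ⧸ I) (r.eval 1) * ab := fun r => by
    rw [← hπa, ← aeval_algHom_apply, hπa, ← hab]
    exact aeval_eq_of_isIdempotentElem ha r
  -- split the roots: `λ ≡ 1` versus the rest
  set s₁ := s.filter fun x => x - 1 ∈ maximalIdeal R
  set s₂ := s.filter fun x => ¬ (x - 1 ∈ maximalIdeal R)
  have hs12 : s = s₁ + s₂ := (Multiset.filter_add_not _ s).symm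
  set g : R[X] := (s₁.map fun x => X - C x).prod with hg
  set h : R[X] := (s₂.map fun x => X - C x).prod with hh
  have hp : (s.map fun x => X - C x).prod = g * h := by rw [hs12, Multiset.map_add, Multiset.prod_add]
  have hgh : aeval a (g * h) = 0 := by rw [← hp]; exact hs
  -- the relation read modulo `I`
  have hrel : algebraMap R (A ⧸ I) ((g * h).eval 0) * (1 - ab) + algebraMap R (A ⧸ I) ((g * h).eval 1) * ab = 0 := by
    rw [← heval, hgh, map_zero]
  -- `h(1)` is a unit of `R`, `g(0)` is a unit of `R`
  have hh1 : IsUnit (h.eval 1) := by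
    rw [hh, eval_prod_X_sub_C]
    refine Multiset.prod_induction _ _ (fun x y hx hy => hx.mul hy) isUnit_one fun x hx => ?_
    obtain ⟨b, hb, rfl⟩ := Multiset.mem_map.1 hx
    exact isUnit_one_sub_of_sub_one_not_mem (R := R) ((Multiset.mem_filter.1 hb).2)
  have hg0 : IsUnit (g.eval 0) := by
    rw [hg, eval_prod_X_sub_C]
    refine Multiset.prod_induction _ _ (fun x y hx hy => hx.mul hy) isUnit_one fun x hx => ?_
    obtain ⟨b, hb, rfl⟩ := Multiset.mem_map.1 hx
    rw [zero_sub, IsUnit.neg_iff]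
    exact isUnit_of_sub_one_mem (R := R) ((Multiset.mem_filter.1 hb).2)
  by_cases hs₁0 : s₁ = 0
  · -- no root is `≡ 1`: then `ā = 0`, lift by `0`
    have hg1 : g = 1 := by rw [hg, hs₁0, Multiset.map_zero, Multiset.prod_zero]
    refine ⟨0, IsIdempotentElem.zero, ?_⟩
    rw [map_zero]
    -- multiply the relation by `ā`: `h(1)·ā = 0`
    have h2 : algebraMap R (A ⧸ I) (h.eval 1) * ab = 0 := by
      have hidem : ab * ab = ab := ha.eq
      have := congrArg (fun z => z * ab) hrel
      simp only [hg1, one_mul, zero_mul, add_mul] at this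
      have e1 : algebraMap R (A ⧸ I) (h.eval 0) * (1 - ab) * ab = 0 := by
        rw [mul_assoc, sub_mul, one_mul, hidem, sub_self, mul_zero]
      rw [e1, zero_add, mul_assoc, hidem] at this
      exact this
    obtain ⟨c, hc⟩ := hh1.exists_left_inv
    refine Eq.symm ?_
    calc ab = algebraMap R (A ⧸ I) (c * h.eval 1) * ab := by rw [hc, map_one, one_mul]
      _ = algebraMap R (A ⧸ I) c * (algebraMap R (A ⧸ I) (h.eval 1) * ab) := by rw [map_mul, mul_assoc]
      _ = 0 := by rw [h2, mul_zero]
  · -- some root is `≡ 1`: Bézout `u g + v h = 1`, `e := (v h)(a)`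
    have hcop : IsCoprime g h :=
      isCoprime_prod_X_sub_C s₁ s₂ fun x hx y hy =>
        isUnit_sub_of_sub_one_mem_of_sub_one_not_mem (R := R) ((Multiset.mem_filter.1 hx).2) ((Multiset.mem_filter.1 hy).2)
    obtain ⟨u, v, huv⟩ := hcop
    refine ⟨aeval a (v * h), ?_, ?_⟩
    · -- idempotent: `(vh)² = vh − uv·(gh)` and `(gh)(a) = 0`
      have key : (v * h) * (v * h) = v * h + (-(u * v)) * (g * h) := by linear_combination (v * h) * huv
      change aeval a (v * h) * aeval a (v * h) = aeval a (v * h)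
      rw [← map_mul, key, map_add, map_mul (aeval a) (-(u * v)), hgh, mul_zero, add_zero]
    · -- reduction: `(vh)(1) ≡ 1` and `(vh)(0)(1 − ā) ≡ 0`
      rw [heval]
      -- `g(1) ∈ 𝔪`
      have hg1 : g.eval 1 ∈ maximalIdeal R := by
        obtain ⟨x, hx⟩ := Multiset.exists_mem_of_ne_zero hs₁0
        obtain ⟨s₁', hs₁'⟩ := Multiset.exists_cons_of_mem hx
        rw [hg, hs₁', Multiset.map_cons, Multiset.prod_cons, eval_mul, eval_sub, eval_X, eval_C]
        refine Ideal.mul_mem_right _ _ ?_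
        have : (1 : R) - x = -(x - 1) := by ring
        rw [this]
        exact (Ideal.neg_mem_iff _).2 ((Multiset.mem_filter.1 hx).2)
      -- `(vh)(1) = 1 − u(1) g(1) ↦ 1`
      have hvh1 : algebraMap R (A ⧸ I) ((v * h).eval 1) = 1 := by
        have e1 : (v * h).eval 1 = 1 - u.eval 1 * g.eval 1 := by
          have := congrArg (eval 1) huv
          rw [eval_add, eval_mul, eval_mul, eval_one] at this
          rw [eval_mul]
          linear_combination this
        rw [e1, map_sub, map_one, map_mul, halg _ hg1, mul_zero, sub_zero]
      -- `h(0)(1 − ā) = 0` from the relation times `(1 − ā)` and the unit `g(0)`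
      have hh0 : algebraMap R (A ⧸ I) (h.eval 0) * (1 - ab) = 0 := by
        have hidem' : (1 - ab) * (1 - ab) = 1 - ab := ha.one_sub.eq
        have := congrArg (fun z => z * (1 - ab)) hrel
        simp only [add_mul, zero_mul] at this
        have e2 : algebraMap R (A ⧸ I) ((g * h).eval 1) * ab * (1 - ab) = 0 := by
          rw [mul_assoc, mul_sub, mul_one, ha.eq, sub_self, mul_zero]
        rw [e2, add_zero, mul_assoc, hidem', eval_mul, map_mul, mul_assoc] at this
        obtain ⟨c, hc⟩ := hg0.exists_left_inv
        calc algebraMap R (A ⧸ I) (h.eval 0) * (1 - ab)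
            = algebraMap R (A ⧸ I) (c * g.eval 0) * (algebraMap R (A ⧸ I) (h.eval 0) * (1 - ab)) := by
              rw [hc, map_one, one_mul]
          _ = algebraMap R (A ⧸ I) c * (algebraMap R (A ⧸ I) (g.eval 0) * (algebraMap R (A ⧸ I) (h.eval 0) * (1 - ab))) := by
              rw [map_mul, mul_assoc]
          _ = 0 := by rw [this, mul_zero]
      rw [hvh1, one_mul, eval_mul, map_mul, mul_assoc, hh0, mul_zero, zero_add]

end Lift

/-! ### §3 Complete orthogonal families; `𝔪A ⊆ Jac(A)` for integral extensions -/

section Family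

variable {R A : Type*} [CommRing R] [IsLocalRing R] [CommRing A] [Algebra R A]

/-- For `A` INTEGRAL over the local ring `R` (e.g. module-finite), `𝔪A` lies in the Jacobson radical of `A`: every maximal ideal of `A`
contracts to the maximal ideal of `R` ([Matsumura1987] Thm. 9.3), hence contains `𝔪A`. [cite: Matsumura1987, Thm. 9.3] -/
theorem map_maximalIdeal_le_jacobson_bot [Nontrivial A] [Algebra.IsIntegral R A] :
    (maximalIdeal R).map (algebraMap R A) ≤ Ideal.jacobson (⊥ : Ideal A) := by
  intro x hx
  rw [Ideal.jacobson, Ideal.mem_sInf]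
  rintro J ⟨-, hJ⟩
  haveI := hJ
  have hc : (J.comap (algebraMap R A)).IsMaximal := Ideal.isMaximal_comap_of_isIntegral_of_isMaximal J
  have hle : maximalIdeal R ≤ J.comap (algebraMap R A) := (IsLocalRing.eq_maximalIdeal hc).ge
  exact Ideal.map_le_iff_le_comap.2 hle hx

/-- **Lifting a complete orthogonal family of idempotents** along `A → A ⧸ I`, `𝔪A ⊆ I ⊆ Jac(A)`, when every element of `A` satisfies a
split monic relation over the local base `R`: orthogonality and completeness come for free, because an idempotent inside `Jac(A)` vanishes.
[cite: StacksProject, Tag 04GG] [cite: StacksProject, Tag 09XI] -/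
theorem exists_completeOrthogonalIdempotents_lift (I : Ideal A) (hI : (maximalIdeal R).map (algebraMap R A) ≤ I)
    (hIJ : I ≤ Ideal.jacobson (⊥ : Ideal A))
    (hsplit : ∀ a : A, ∃ s : Multiset R, aeval a (s.map fun x => X - C x).prod = 0)
    {ι : Type*} [Fintype ι] (eb : ι → A ⧸ I) (heb : CompleteOrthogonalIdempotents eb) :
    ∃ e : ι → A, CompleteOrthogonalIdempotents e ∧ ∀ i, Ideal.Quotient.mk I (e i) = eb i := by
  classical
  -- lift each class
  have hlift : ∀ i, ∃ e : A, IsIdempotentElem e ∧ Ideal.Quotient.mk I e = eb i := fun i => by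
    obtain ⟨a, ha⟩ := Ideal.Quotient.mk_surjective (eb i)
    obtain ⟨s, hs⟩ := hsplit a
    obtain ⟨e, he, hea⟩ := exists_isIdempotentElem_mk_eq_of_aeval_prod_X_sub_C_eq_zero I hI a (by rw [ha]; exact heb.idem i) s hs
    exact ⟨e, he, by rw [hea, ha]⟩
  choose e he hemk using hlift
  have hortho : Pairwise fun i j => e i * e j = 0 := fun i j hij => by
    have hid : IsIdempotentElem (e i * e j) := (he i).mul (he j)
    refine eq_zero_of_isIdempotentElem_of_mem_jacobson_bot hid (hIJ ?_)
    rw [← Ideal.Quotient.eq_zero_iff_mem, map_mul, hemk, hemk]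
    exact heb.ortho hij
  have horth : OrthogonalIdempotents e := ⟨he, hortho⟩
  refine ⟨e, ⟨horth, ?_⟩, hemk⟩
  -- completeness: `1 − Σ eᵢ` is an idempotent in `I ⊆ Jac(A)`
  have hsum : IsIdempotentElem (∑ i, e i) := horth.isIdempotentElem_sum
  have h1 : IsIdempotentElem (1 - ∑ i, e i) := hsum.one_sub
  have hmem : (1 - ∑ i, e i) ∈ I := by
    rw [← Ideal.Quotient.eq_zero_iff_mem, map_sub, map_one, map_sum]
    simp_rw [hemk]
    rw [heb.complete, sub_self]
  have := eq_zero_of_isIdempotentElem_of_mem_jacobson_bot h1 (hIJ hmem)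
  exact (sub_eq_zero.1 this).symm

end Family

/-! ### §4 The valuation ring of an algebraically closed field -/

section Valuation

variable {Ω : Type*} [Field Ω] [IsAlgClosed Ω] (V : ValuationSubring Ω)
variable {A : Type*} [CommRing A] [Algebra V A]

/-- **Split relations over the valuation ring of an algebraically closed field**: every element of an INTEGRAL `V`-algebra is killed by a
product `∏ (X − λ)` with all `λ ∈ V` (its monic relation splits over `Ω`, and the roots are integral over `V`, hence in `V` — ★
`ValuationSubring.mem_of_isRoot_map_of_monic`). [cite: StacksProject, Tag 00IC] -/
theorem exists_aeval_prod_X_sub_C_eq_zero_of_valuationSubring [Algebra.IsIntegral V A] (a : A) :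
    ∃ s : Multiset V, aeval a (s.map fun x => X - C x).prod = 0 := by
  classical
  obtain ⟨f, hf, hfa⟩ := Algebra.IsIntegral.isIntegral (R := V) a
  have hsplit : (f.map (algebraMap V Ω)).Splits := IsAlgClosed.splits _
  have hmon : (f.map (algebraMap V Ω)).Monic := hf.map _
  have hroots : ∀ α ∈ (f.map (algebraMap V Ω)).roots, α ∈ V := fun α hα =>
    V.mem_of_isRoot_map_of_monic hf ((mem_roots hmon.ne_zero).1 hα)
  -- the roots as a multiset of `V`
  set s : Multiset V := (f.map (algebraMap V Ω)).roots.pmap (fun α hα => (⟨α, hα⟩ : V)) hroots with hs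
  have hsval : s.map (fun x : V => (x : Ω)) = (f.map (algebraMap V Ω)).roots := by
    rw [hs, Multiset.map_pmap]
    exact (Multiset.pmap_eq_map _ _ _ _).trans (Multiset.map_id' _)
  refine ⟨s, ?_⟩
  -- `f = ∏ (X − λ)` in `V[X]` (compare in `Ω[X]`)
  have hfs : f = (s.map fun x => X - C x).prod := by
    apply Polynomial.map_injective (algebraMap V Ω) Subtype.val_injective
    rw [hsplit.eq_prod_roots_of_monic hmon, Polynomial.map_multiset_prod, Multiset.map_map, ← hsval, Multiset.map_map]
    refine congrArg Multiset.prod (Multiset.map_congr rfl fun x _ => ?_)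
    simp only [Function.comp_apply, Polynomial.map_sub, map_X, map_C]
    rfl
  rw [← hfs]
  exact hfa

/-- **Idempotent lifting over the valuation ring of an algebraically closed field** (Hensel-free [StacksProject 04GG (5)] in this case):
for `A` integral over `V` (e.g. module-finite), `I ⊇ 𝔪_V A`, every idempotent of `A ⧸ I` lifts to an idempotent of `A`.
[cite: StacksProject, Tag 04GG] [cite: StacksProject, Tag 09XI] -/
theorem _root_.ValuationSubring.exists_isIdempotentElem_mk_eq [Algebra.IsIntegral V A] (I : Ideal A)
    (hI : (maximalIdeal V).map (algebraMap V A) ≤ I) (a : A) (ha : IsIdempotentElem (Ideal.Quotient.mk I a)) :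
    ∃ e : A, IsIdempotentElem e ∧ Ideal.Quotient.mk I e = Ideal.Quotient.mk I a := by
  obtain ⟨s, hs⟩ := exists_aeval_prod_X_sub_C_eq_zero_of_valuationSubring V a
  exact Literature.RingTheory.Idempotents.exists_isIdempotentElem_mk_eq_of_aeval_prod_X_sub_C_eq_zero I hI a ha s hs

/-- **Complete orthogonal idempotents of the special fibre lift** for an integral algebra `A` over the valuation ring `V` of an algebraically
closed field: every complete orthogonal family of idempotents of `A ⧸ 𝔪_V A` is the reduction of a complete orthogonal family of idempotents
of `A` (so `A ≅ ∏ᵢ A ⧸ (1 − eᵢ)` by Mathlib's `CompleteOrthogonalIdempotents.bijective_pi`: a finite `V`-algebra is the product of the blocks of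
its special fibre). [cite: StacksProject, Tag 04GG] [cite: StacksProject, Tag 09XI] -/
theorem _root_.ValuationSubring.exists_completeOrthogonalIdempotents_lift [Nontrivial A] [Algebra.IsIntegral V A]
    {ι : Type*} [Fintype ι] (eb : ι → A ⧸ (maximalIdeal V).map (algebraMap V A)) (heb : CompleteOrthogonalIdempotents eb) :
    ∃ e : ι → A, CompleteOrthogonalIdempotents e ∧ ∀ i, Ideal.Quotient.mk _ (e i) = eb i :=
  Literature.RingTheory.Idempotents.exists_completeOrthogonalIdempotents_lift _ le_rfl map_maximalIdeal_le_jacobson_bot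
    (exists_aeval_prod_X_sub_C_eq_zero_of_valuationSubring V) eb heb

end Valuation

end Literature.RingTheory.Idempotents
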